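import Literature.MathematicalPhysics.QuantumFieldTheory.Balaban1983to89.B9SectBGpStepAtLettersV2
import Literature.MathematicalPhysics.QuantumFieldTheory.Balaban1983to89.B9Thm34InvBlk

/-!
# Balaban, *Propagators for lattice gauge theories in a background field* [B9], (3.65)–(3.67) p. 403 over Thm 3.2 (3.48) p. 398 —
# the C⁻¹ = (Q′G′²Q′*)⁻¹ clause of Sect. B AT THE LETTERS, FRAME V3: the letters dictionary `CinvFrame₃` with a DISPLAYED BLOCK
# CARRIER `P i → 𝔅` (𝔤-valued block functions in a real basis, P = blocks × ι′) and ★ `stepKerPos_of_cinvFrame₃`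

Companion of `B9SectBGpStepAtLettersV2` (§2 there: `CinvFrame₂` ∕ ★ `stepKerPos_of_cinvFrame₂`, the case P = 𝔅) built on r06's BLOCK-CARRIER
twin `B9Thm34InvBlk.thm34_Cinv_uniform_blk` of the scalar clause `B9Thm34SectBUniformR1.thm34_Cinv_uniform`.

WHY A V3.  The V2 frame `CinvFrame₂` types the (3.19) letters Q′(U) ∕ Q′*(U) as Hom letters between the fine lattice `S i × ι` and the REAL
functions on 𝔅 = `(geo i).Site`, and the letter C⁻¹(V) as an operator on `(geo i).Site → ℝ`: one real unknown per block.  Print's C(U) =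
Q′(U)G′(U)²Q′*(U) of (3.21) acts on 𝔤-VALUED block functions ((3.19): Q′ averages the 𝔤-valued site field over the block with the
transporters U(Γ_{y,x})), i.e. on `P → ℝ` with `P = 𝔅 × ι′` in a real basis of 𝔤 (for the tree's concrete letters of node00-def-Y: `P = BlkY × ι`,
block map `ι_B ∘ Prod.fst`, the carrier blocks `β` labelled by the index bonds).  r06's `thm34_Cinv_uniform_blk` (R-Ker-2) is the (3.48)-clause for an
ARBITRARY finite block carrier `P` with block map `blkP : P → 𝔅`, Theorem 3.2's bound read as the BLOCK MAJORANT `B₁(Lʲη)⁻⁴e^{−δd(y,y′)}` for `blkP`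
([4] (2.51): fibre-row sums — no multiplicity factor in the statement; the entrywise reading with the displayed fibre multiplicity is
`B9Thm34InvBlk.hasMajorant_blk_of_entry_le` ∕ `entry_le_of_hasMajorant_blk`), constants and thresholds LITERALLY those of the scalar clause.
THIS FILE re-types the V2 frame over that clause: `CinvFrame₃ P Cinv` = `GpFrame₂` (the G′ letters, unchanged) extended by the block map
`blkP i : P i → (geo i).Site`, the letters `Qc i U : (S i × ι → ℝ) →ₗ (P i → ℝ)`, `Qcs i U`, `Cop i V : Module.End ℝ (P i → ℝ)`, the (3.57)
variations `Fc ∕ Fcs`, their laws (`hQc hQcs cop_eq reg_cinv q_mul hF` — shapes = the hypotheses of `thm34_Cinv_uniform_blk` verbatim; V3 THRESHOLDS `hQc ∕ hQcs`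
at (3.35)-regular U like `reg_cinv`, which is all the step uses), and the
two kernel readings of the family `Cinv i` against BLOCK MAJORANTS of the letter for `blkP i` (`readKer` ∕ `writeKer`; the (2.69) pairing weight
`(L^{j′}η)^{−dB}` of the family's (3.48) reading lives in the readings, not in the majorant); and proves
★ `stepKerPos_of_cinvFrame₃ : CinvFrame₃ … P Cinv → StepKerPos F.dB c35 geo bg Gp GA Cinv Cinv` — the V2 proof verbatim with the block-carrier
clause (no [4]-(2.61)-dimension change of the kernel reading is needed any more: the majorant carries no volume weight).

HONEST FRAMING.  A hypothesis structure and one composition theorem; nothing of print asserted beyond what r06's two uniform clauses prove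
(`thm34_Gp_uniform` R1 for the inverse identities of the extension, `thm34_Cinv_uniform_blk` for C⁻¹(U′U)).  The INSTANCE over node00-def-Y's
letters (`Qc` = the coordinates of `QpY`, `Cop` = the inverse of the coordinates of η⁴·`XY`, the family `Cinv` = the `siteKernelOfOp` reading of
`CY = XinvY ∘ diag(cWtY)` at the carrier blocks `β`) is NOT in this file (unit dag-n06-c, next: the (3.19) block-locality of `QpY ∕ QpsY`, the
(3.57)∕(3.59) transporter variation along `parS`, the kernel read/write through `cWtY`, and the displayed invertibility of `XY` at (3.35)-regular U).
Fixed `k`; one finite-lattice programme — not continuum ∕ OS ∕ mass gap ∕ Clay.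
-/

namespace Literature.MathematicalPhysics.QuantumFieldTheory.Balaban1983to89.B9SectBKerFrameV3

open Literature.MathematicalPhysics.QuantumFieldTheory.Balaban1983to89.B6RandomWalk (HasMajorant hasMajorant_mono)
open Literature.MathematicalPhysics.QuantumFieldTheory.Balaban1983to89.B6RandomWalkHom (HasMajorantHom)
open Literature.MathematicalPhysics.QuantumFieldTheory.Balaban1983to89.B9Thm34Ext (toB6)
open Literature.MathematicalPhysics.QuantumFieldTheory.Balaban1983to89.B9SectBStepWhole (StepKerPos)
open Literature.MathematicalPhysics.QuantumFieldTheory.Balaban1983to89.B9Thm34SectBUniformR1 (thm34_Gp_uniform)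
open Literature.MathematicalPhysics.QuantumFieldTheory.Balaban1983to89.B9Thm34InvBlk (thm34_Cinv_uniform_blk)
open Literature.MathematicalPhysics.QuantumFieldTheory.Balaban1983to89.B9SectBGpStepAtLettersV2 (GpFrame₂)

universe u

variable {I : Type} (c35 : ℝ) (geo : I → B9.Geometry) (bg : I → B9.Backgrounds)
  (Gp : ∀ i, B9.KernelFamily (geo i) (bg i))
  {𝔸 : Type u} [NormedRing 𝔸] [NormedAlgebra ℂ 𝔸] [CompleteSpace 𝔸] {ι : Type} [Fintype ι] [DecidableEq ι]
  (b : Module.Basis ι ℝ 𝔸) (κ : Type) [Fintype κ]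
  (S : I → Type) [∀ i, Fintype (S i)] [∀ i, DecidableEq (S i)]
  [∀ i, Fintype (geo i).Site] [∀ i, DecidableEq (geo i).Site] [∀ i, Nonempty (geo i).Site]
  (P : I → Type) [∀ i, Fintype (P i)] [∀ i, DecidableEq (P i)]

/-- **THE LETTERS DICTIONARY FOR THE PAIR (G′, C⁻¹) OVER A BLOCK CARRIER** — `GpFrame₂` extended by: the block carrier's block map
`blkP i : P i → 𝔅` (P = the points of the 𝔤-valued block functions, (3.19) ∕ (3.8)), the (3.19) letters Q′(U), Q′*(U) as Hom letters between the
fine lattice and the block carrier (`Qc`, `Qcs`; block-local majorants κ_Q at (3.35)-regular U above the thresholds — `hQc` ∕ `hQcs`, THRESHOLDED in V3, [4] (2.51)), the letter `Cop i V` = C⁻¹(V) = (Q′(V)G′(V)²Q′*(V))⁻¹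
(3.21) as an operator on the functions on the block carrier with its laws `cop_eq` (it is THE two-sided inverse whenever one exists) and `reg_cinv`
((3.21) exists at (3.35)-regular U above the thresholds, Thm 3.2 ∕ 3.11), the (3.57) law `q_mul`: Q′(U′U) = Q′(U) + F′(A), Q′*(U′U) = Q′*(U) + F′*(A)
with the (3.59) majorants c_F·α₁ (`hF`), and the two readings of the family `Cinv i` against block majorants of the letter for `blkP i`: `readKer`
(the family's (3.48) bound at U with (B₁, δ), pairing weight `(L^{j′}η)^{−dB}`, ⇒ the block majorant `cK·B₁·(Lʲη)⁻⁴e^{−δd}` of C⁻¹(U)) and `writeKer`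
(a block majorant `B·(Lʲη)⁻⁴e^{−δd}` of C⁻¹(U′U) ⇒ the family's bound at U′U with the writing functions `wK`, `wKδ`).  Field shapes = the hypotheses
of `B9Thm34InvBlk.thm34_Cinv_uniform_blk` verbatim.  A hypothesis structure; nothing asserted.
[cite: Balaban1985BackgroundPropagators, Thm 3.2 (3.48) p.398 + (3.19)–(3.21) pp.393–394 + (3.8) p.392 + (3.57)–(3.59) p.402 + (3.65)–(3.67) p.403 + Thm 3.11 p.416; Balaban1984PropagatorsII, (2.51) p.232 + (2.69) p.235] -/
structure CinvFrame₃ (Cinv : ∀ i, B9.SiteKernel (geo i) (bg i)) extends GpFrame₂ c35 geo bg Gp b κ S where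
  blkP : ∀ i, P i → (geo i).Site
  κQ : ℝ
  cF : ℝ
  cK : ℝ
  wK : ℝ → ℝ → ℝ
  wKδ : ℝ → ℝ
  κQ_pos : 0 < κQ
  cF_pos : 0 < cF
  cK_pos : 0 < cK
  wK_pos : ∀ B δ : ℝ, 0 ≤ B → 0 < δ → 0 < wK B δ
  wKδ_pos : ∀ δ : ℝ, 0 < δ → 0 < wKδ δ
  Qc : ∀ i, (bg i).Cfg → (S i × ι → ℝ) →ₗ[ℝ] (P i → ℝ)
  Qcs : ∀ i, (bg i).Cfg → (P i → ℝ) →ₗ[ℝ] (S i × ι → ℝ)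
  Cop : ∀ i, (bg i).Cfg → Module.End ℝ (P i → ℝ)
  Fc : ∀ i, (bg i).Cfg → (bg i).Cfg → (S i × ι → ℝ) →ₗ[ℝ] (P i → ℝ)
  Fcs : ∀ i, (bg i).Cfg → (bg i).Cfg → (P i → ℝ) →ₗ[ℝ] (S i × ι → ℝ)
  /-- (3.19) at a (3.35)-regular U above the thresholds (V3: thresholded like `reg_cinv` — the step uses the letters Q′(U), Q′*(U) at the regular
  base only; at U′U they enter through `q_mul`): Q′(U), Q′*(U) are block-local with entries ≦ κ_Q. -/
  hQc : ∀ i (α₀ : ℝ) (U : (bg i).Cfg), MInv ≤ (geo i).M → 0 < α₀ → (geo i).M * α₀ ≤ aInv → (bg i).Reg335 c35 α₀ U →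
    HasMajorantHom (g := toB6 (geo i) (Rr i) (Hp i)) (fun p : S i × ι => blk i p.1)
      (blkP i) (Qc i U) (fun a a' : (geo i).Site => κQ * (if a = a' then (1 : ℝ) else 0))
  hQcs : ∀ i (α₀ : ℝ) (U : (bg i).Cfg), MInv ≤ (geo i).M → 0 < α₀ → (geo i).M * α₀ ≤ aInv → (bg i).Reg335 c35 α₀ U →
    HasMajorantHom (g := toB6 (geo i) (Rr i) (Hp i)) (blkP i)
      (fun p : S i × ι => blk i p.1) (Qcs i U) (fun a a' : (geo i).Site => κQ * (if a = a' then (1 : ℝ) else 0))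
  /-- `C⁻¹(V)` is THE two-sided inverse of `Q′(V)G′(V)²Q′*(V)` whenever one exists (every configuration). -/
  cop_eq : ∀ i (V : (bg i).Cfg) (D X : Module.End ℝ (P i → ℝ)),
    Qc i V ∘ₗ (Gop i V * Gop i V) ∘ₗ Qcs i V = D → X * D = 1 → D * X = 1 → Cop i V = X
  /-- (3.21) at a (3.35)-regular U above the thresholds: C(U)·C⁻¹(U) = 1 (Thm 3.2 ∕ 3.11). -/
  reg_cinv : ∀ i (α₀ : ℝ) (U : (bg i).Cfg), MInv ≤ (geo i).M → 0 < α₀ → (geo i).M * α₀ ≤ aInv → (bg i).Reg335 c35 α₀ U →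
    (Qc i U ∘ₗ (Gop i U * Gop i U) ∘ₗ Qcs i U) * Cop i U = 1
  /-- (3.57): Q′(U′U) = Q′(U) + F′(A), Q′*(U′U) = Q′*(U) + F′*(A) on the class (3.37). -/
  q_mul : ∀ i (α₁ : ℝ) (U U' : (bg i).Cfg), 0 < α₁ → (bg i).Cplx337 α₁ U U' →
    Qc i ((bg i).mul U' U) = Qc i U + Fc i U U' ∧ Qcs i ((bg i).mul U' U) = Qcs i U + Fcs i U U'
  /-- (3.59): the variations F′(A), F′*(A) are block-local with entries ≦ c_F·α₁. -/
  hF : ∀ i (α₁ : ℝ) (U U' : (bg i).Cfg), 0 < α₁ → (bg i).Cplx337 α₁ U U' →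
    HasMajorantHom (g := toB6 (geo i) (Rr i) (Hp i)) (fun p : S i × ι => blk i p.1) (blkP i) (Fc i U U')
        (fun a a' : (geo i).Site => cF * α₁ * (if a = a' then (1 : ℝ) else 0)) ∧
      HasMajorantHom (g := toB6 (geo i) (Rr i) (Hp i)) (blkP i) (fun p : S i × ι => blk i p.1) (Fcs i U U')
        (fun a a' : (geo i).Site => cF * α₁ * (if a = a' then (1 : ℝ) else 0))
  /-- READING (3.48): the kernel bound of `Cinv i` at U with (B₁, δ) (pairing weight `(L^{j′}η)^{−dB}`) ⇒ the block majorant of C⁻¹(U) for `blkP i`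
  with (cK·B₁, δ). -/
  readKer : ∀ i (α₀ : ℝ) (U : (bg i).Cfg) (B₁ δ : ℝ), MInv ≤ (geo i).M → 0 < α₀ → (geo i).M * α₀ ≤ aInv →
    (bg i).Reg335 c35 α₀ U → 0 < B₁ → 0 < δ →
    (∀ y y' : (geo i).Site, |(Cinv i).ker U y y'| ≤
      B₁ * ((geo i).len y) ^ (-(4 : ℝ)) * ((geo i).len y') ^ (-(dB : ℝ)) * Real.exp (-(δ * (geo i).dist y y'))) →
    HasMajorant (g := toB6 (geo i) (Rr i) (Hp i)) (blkP i) (Cop i U)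
      (fun a a' : (geo i).Site => cK * B₁ * (geo i).len a ^ (-(4 : ℝ)) * Real.exp (-(δ * (geo i).dist a a')))
  /-- WRITING (3.48): a block majorant of C⁻¹(U′U) for `blkP i` with (B, δ) ⇒ the kernel bound of `Cinv i` at U′U with (wK B δ, wKδ δ), U′ in
  (3.37) at α₁ ≦ aW. -/
  writeKer : ∀ i (U U' : (bg i).Cfg) (α₁ B δ : ℝ), 0 < α₁ → α₁ ≤ aW → (bg i).Cplx337 α₁ U U' → 0 ≤ B → 0 < δ →
    HasMajorant (g := toB6 (geo i) (Rr i) (Hp i)) (blkP i) (Cop i ((bg i).mul U' U))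
      (fun a a' : (geo i).Site => B * (geo i).len a ^ (-(4 : ℝ)) * Real.exp (-(δ * (geo i).dist a a'))) →
    ∀ y y' : (geo i).Site, |(Cinv i).ker ((bg i).mul U' U) y y'| ≤
      wK B δ * ((geo i).len y) ^ (-(4 : ℝ)) * ((geo i).len y') ^ (-(dB : ℝ)) * Real.exp (-(wKδ δ * (geo i).dist y y'))

/-- ★ **THE (3.48)-STEP OF SECT. B FOR C⁻¹(U′U), INHABITED AT THE LETTERS OVER A BLOCK CARRIER** ((3.65)–(3.67) p. 403: *"The inverse
satisfies Theorem 3.2"*): every letters dictionary `CinvFrame₃ … P Cinv` inhabits the positive-input kernel step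
`B9SectBStepWhole.StepKerPos F.dB c35 geo bg Gp GA Cinv Cinv` (kernel exponent = the frame's dimension `dB`).  Proof = the V2 proof
(`B9SectBGpStepAtLettersV2.stepKerPos_of_cinvFrame₂`) with r06's BLOCK-CARRIER clause `thm34_Cinv_uniform_blk` at the call rate δ = `rate (min δ₀ δ₁)`
of the input tuple (G′ letters read at δ₀, the family's kernel read as a block majorant at δ₁, both lowered — `hasMajorant_mono`),
`thm34_Gp_uniform` (R1) for the two-sided inverse identities of the extension, uniqueness twice (`gop_eq`: the family's G′(U′U) is r06's
extension; `cop_eq`: the family's C⁻¹(U′U) is r06's inverse `Tinv` of Q′(U′U)G′(U′U)²Q′*(U′U), since Q′(U′U) = Q′(U) + F′(A) by `q_mul`), and the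
kernel writing.  Thresholds: M ≧ MInv, Mα₀ ≦ aInv, α₁ ≦ min(a₁, a₁′, aW); output (wK B′ (9δ/25), wKδ (9δ/25)) with B′ = 2·cK·B₁·c₁(2δ/5, 1/10);
threshold M ≧ Mthr δ.  Nothing of print asserted beyond what r06's two theorems prove. [cite: Balaban1985BackgroundPropagators, Thm 3.4 p.400 + (3.65)–(3.67) p.403 + Thm 3.2 (3.48) p.398 + (3.57)–(3.60) p.402 + Thm 3.11 p.416; Balaban1984PropagatorsII, Lemma 2.1 (2.61) p.234 + (2.51) p.232] -/
theorem stepKerPos_of_cinvFrame₃ {Cinv : ∀ i, B9.SiteKernel (geo i) (bg i)} (F : CinvFrame₃ c35 geo bg Gp b κ S P Cinv)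
    (GA : ∀ i, B9.KernelFamily (geo i) (bg i)) :
    StepKerPos F.dB c35 geo bg Gp GA Cinv Cinv := by
  intro B₀ δ₀ Bβ Bε Bεβ B₁ δ₁ hB₀ hδ₀ hB₁ hδ₁
  -- the CALL RATE δr := min (min δ₀ δ₁) δcap
  have hδm : 0 < min δ₀ δ₁ := lt_min hδ₀ hδ₁
  have hδ : 0 < F.rate (min δ₀ δ₁) := F.rate_pos hδm
  have hδc : F.rate (min δ₀ δ₁) ≤ F.δcap := F.rate_le_cap _
  have hδ0 : F.rate (min δ₀ δ₁) ≤ δ₀ := le_trans (F.rate_le _) (min_le_left _ _)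
  have hδ1 : F.rate (min δ₀ δ₁) ≤ δ₁ := le_trans (F.rate_le _) (min_le_right _ _)
  -- r06's uniform clauses (R1) at the call rate: G′ (for the inverse identities) and C⁻¹ over the block carrier
  obtain ⟨a₁, ha₁, B, -, H⟩ := thm34_Gp_uniform b κ (F.d261 (F.rate (min δ₀ δ₁))) (F.rate (min δ₀ δ₁)) (F.cR * B₀) F.Cq F.a₀ F.d₀ F.M₂
    (F.Λf (F.rate (min δ₀ δ₁))) (mul_pos F.cR_pos hB₀) F.Cq_nonneg F.a₀_nonneg F.M₂_nonneg hδ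
    (fun α hα => F.Λf_one_le _ α hδ hα) F.hrepr
  obtain ⟨a₂, ha₂, H'⟩ := thm34_Cinv_uniform_blk b κ (F.d261 (F.rate (min δ₀ δ₁))) (F.rate (min δ₀ δ₁)) F.κQ (F.cR * B₀) (F.cK * B₁) F.cF
    F.Cq F.a₀ F.d₀ F.M₂ (F.Λf (F.rate (min δ₀ δ₁))) F.κQ_pos (mul_pos F.cR_pos hB₀) (mul_pos F.cK_pos hB₁) F.cF_pos F.Cq_nonneg
    F.a₀_nonneg F.M₂_nonneg hδ (fun α hα => F.Λf_one_le _ α hδ hα) F.hrepr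
  have hδ' : 0 < 9 / 25 * F.rate (min δ₀ δ₁) := by positivity
  have hB' : 0 ≤ 2 * (F.cK * B₁) * B6.c1 (F.d261 (F.rate (min δ₀ δ₁))) (2 / 5 * F.rate (min δ₀ δ₁)) (1 / 10) :=
    mul_nonneg (mul_nonneg zero_le_two (mul_pos F.cK_pos hB₁).le) (B6RandomWalk.c1_nonneg _ _ _)
  refine ⟨F.Mthr (F.rate (min δ₀ δ₁)), min (min a₁ a₂) F.aW, F.aInv,
    (F.wK (2 * (F.cK * B₁) * B6.c1 (F.d261 (F.rate (min δ₀ δ₁))) (2 / 5 * F.rate (min δ₀ δ₁)) (1 / 10)) (9 / 25 * F.rate (min δ₀ δ₁)),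
      F.wKδ (9 / 25 * F.rate (min δ₀ δ₁))),
    F.Mthr_pos _, lt_min (lt_min ha₁ ha₂) F.aW_pos, F.aInv_pos, ⟨F.wK_pos _ _ hB' hδ', F.wKδ_pos _ hδ'⟩, ?_⟩
  intro i hM0 α₀ hα₀ hMa U hU hT α₁ hα₁ ha U' hU'
  have hM : F.MInv ≤ (geo i).M := F.MInv_le_of_Mthr_le hM0
  have ha1 : α₁ ≤ a₁ := le_trans ha (le_trans (min_le_left _ _) (min_le_left _ _))
  have ha2 : α₁ ≤ a₂ := le_trans ha (le_trans (min_le_left _ _) (min_le_right _ _))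
  have haW : α₁ ≤ F.aW := le_trans ha (min_le_right _ _)
  -- the letters at U: G′(U) inverts Δ′_a(U); (3.42)₀,₁,₂ at δ₀ lowered to the call rate; the kernel (3.48) at δ₁ read as a block majorant, lowered likewise
  obtain ⟨hΔG, hGΔ⟩ := F.reg_inv i α₀ U hM hα₀ hMa hU
  obtain ⟨h1', h2', h3', -⟩ := F.read342_le i α₀ U hM hα₀ hMa hU hB₀ hδ₀ hδ0 hT.1.1.1
  have hK := F.readKer i α₀ U B₁ δ₁ hM hα₀ hMa hU hB₁ hδ₁ hT.2.1
  have hK' : HasMajorant (g := toB6 (geo i) (F.Rr i) (F.Hp i)) (F.blkP i) (F.Cop i U)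
      (fun a a' => F.cK * B₁ * (geo i).len a ^ (-(4 : ℝ)) * Real.exp (-(F.rate (min δ₀ δ₁) * (geo i).dist a a'))) := by
    refine hasMajorant_mono (g := toB6 (geo i) (F.Rr i) (F.Hp i)) (F.blkP i) hK fun a a' => ?_
    refine mul_le_mul_of_nonneg_left (Real.exp_le_exp.2 ?_) ?_
    · nlinarith [F.dist_nonneg i a a', hδ1]
    · exact mul_nonneg (mul_pos F.cK_pos hB₁).le (Real.rpow_nonneg (F.len_pos i a).le _)
  obtain ⟨hkF, hsF, h337s, h337F, h337B, hA, hAτ⟩ := F.cplx i α₁ U U' hα₁ hU'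
  obtain ⟨hQm, hQsm⟩ := F.q_mul i α₁ U U' hα₁ hU'
  obtain ⟨hFc, hFcs⟩ := F.hF i α₁ U U' hα₁ hU'
  -- the G′ clause: the inverse identities of the extension ⇒ the family's G′(U′U) is r06's extension
  obtain ⟨hinv1, hinv2, -, -⟩ := H (F.T i) (F.coord i U) (F.blk i) (F.kQ i U) (F.sQ i U) (F.cfun i) (F.w i U)
    (F.dist_nonneg i) (F.triangle i) (F.dist_self i) (F.dist_comm i) (F.len_pos i) (F.eta_le_len i) (F.eta_pos i)
    (F.h261_of i hδ hδc hM0) (F.hST_of i hδ hδc hM0) (F.unitary i U)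
    (F.stencilB i) (F.stencilF i) (F.stencil0 i) (F.w_nonneg i U) (F.card_w i U) (F.hkQ i U) (F.hsQ i U) (F.hcfun i)
    hΔG hGΔ h1' h2' h3' α₁ hα₁.le ha1 (F.expA i U U') (F.kF i U U') (F.sF i U U')
    hkF hsF h337s h337F h337B hA hAτ
  have hG := F.gop_eq i ((bg i).mul U' U) _ _ (F.mul_law i α₁ U U' hα₁ hU') hinv1 hinv2
  -- the C⁻¹ clause over the block carrier: r06's inverse of Q′(U′U)G′(U′U)²Q′*(U′U) with its block majorant
  obtain ⟨Tinv, hT1, hT2, hker⟩ := H' (F.T i) (F.coord i U) (F.blk i) (F.blkP i) (F.kQ i U) (F.sQ i U) (F.cfun i) (F.w i U)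
    (F.dist_nonneg i) (F.triangle i) (F.dist_self i) (F.dist_comm i) (F.len_pos i) (F.eta_le_len i) (F.eta_pos i)
    (F.h261_of i hδ hδc hM0) (F.hST_of i hδ hδc hM0) (F.unitary i U)
    (F.stencilB i) (F.stencilF i) (F.stencil0 i) (F.w_nonneg i U) (F.card_w i U) (F.hkQ i U) (F.hsQ i U) (F.hcfun i)
    h1' h2' (F.hQc i α₀ U hM hα₀ hMa hU) (F.hQcs i α₀ U hM hα₀ hMa hU) (F.reg_cinv i α₀ U hM hα₀ hMa hU) hK' α₁ hα₁.le ha2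
    (F.expA i U U') (F.kF i U U') (F.sF i U U') hkF hsF h337s hA hAτ hQm hQsm hFc hFcs
  rw [← hG] at hT1 hT2
  have hC := F.cop_eq i ((bg i).mul U' U) _ Tinv rfl hT1 hT2
  rw [← hC] at hker
  exact F.writeKer i U U' α₁ _ _ hα₁ haW hU' hB' hδ' hker

end Literature.MathematicalPhysics.QuantumFieldTheory.Balaban1983to89.B9SectBKerFrameV3
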